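import Literature.Analysis.FluidPDE.SteadyNSBoundedAnalytic
import Literature.Analysis.FluidPDE.ClassicalBoundedWeak
import Literature.Analysis.FluidPDE.SteadyNSSolution
import Literature.Analysis.FluidPDE.NewtonKernel
import HarnessLib

/-!
# Bounded classical steady Navier–Stokes solutions on `ℝ³` are smooth (indeed real-analytic)

Analysis/FluidPDE proofs file (theorems only; no definitions, no named facts).  The tree's light
steady class `IsSteadyNSSolution ν f U P` (`SteadyNSSolution.lean`: `U ∈ C²`, `P ∈ C¹`,
`−νΔU + (U·∇)U + ∇P = f`, `div U = 0` pointwise) and Leray's class `IsDSolution` are stated with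
the MINIMAL classical regularity of W. Wang's (0.1); the literature then uses freely that such
solutions are `C^∞` ("众所周知, (0.1) 的弱解属于 `W^{1,2}_loc(ℝ³)` 实际上是光滑的" — it is well known
that weak solutions of (0.1) in `W^{1,2}_loc` are in fact smooth, Wang 2025 p. 28 after
Galdi 2011, Thm X.1.1).  This file proves the case the tree's whole-space facts need:

* `IsSteadyNSSolution.isBoundedWeakNSSolutionOn_const` — a `C²/C¹` steady solution of the unforced
  system with BOUNDED velocity is, as a constant-in-time field, a bounded weak Navier–Stokes
  solution on every time interval in the sense of Koch–Nadirashvili–Seregin–Šverák 2009 §4 (ii)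
  (pair the equation with a divergence-free test field; the pressure drops out; integrate the
  exact time derivative `∂ₜ⟪W, ψ⟫` over the time support);
* `IsSteadyNSSolution.analyticOnNhd_of_bounded` — hence (unit viscosity) the velocity is
  real-analytic: the tree's route `SteadyNSBoundedMild` / `SteadyNSBoundedAnalytic` (the steady
  field is Oseen-mild, `eq_heatExtension_sub_oseenDuhamel_of_isBoundedWeakNSSolutionOn`, and
  coincides with the real-analytic local Oseen solution from its own datum, Lemarié-Rieusset 2016
  Thm 9.12, by uniqueness of bounded mild solutions), which never used more than continuity,
  boundedness and the weak formulation;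
* `IsSteadyNSSolution.contDiff_of_bounded` (any `ν > 0`, by the viscosity normalisation) and
  `IsDSolution.contDiff_of_tendsto` — velocity AND pressure are `C^∞` (`∇P = νΔU − (U·∇)U`); in
  particular every `D`-solution with `U → 0` at infinity (Wang's (0.1)–(0.3)) is smooth.

## References

* G. P. Galdi, *An Introduction to the Mathematical Theory of the Navier–Stokes Equations:
  Steady-State Problems*, 2nd ed. (Springer 2011), Thm X.1.1 (interior regularity of steady weak
  solutions). [Galdi2011]
* W. Wang (王文栋), *稳态Navier–Stokes方程的Liouville定理* (Science Press 2025), p. 28 (held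
  `book:anonnd-navier-stokesliouville`, chunk p0028). [Wang2025]
* G. Koch, N. Nadirashvili, G. Seregin, V. Šverák, Acta Math. 203 (2009) = arXiv:0709.3599, §4 (ii)
  (bounded weak solutions), Lemma 3.1. [KochNadirashviliSereginSverak2009]
* P. G. Lemarié-Rieusset, *The Navier–Stokes Problem in the 21st Century* (CRC 2016), Thm 9.12.
  [LemarieRieusset2016]
-/

noncomputable section

open MeasureTheory Set Function Filter Topology TopologicalSpace InnerProductSpace Metric
open scoped RealInnerProductSpace Laplacian ENNReal NNReal

namespace Literature.Analysis.FluidPDE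

open UnboundedOperators (heatExtension)

/-! ### The steady tested identity and the bounded weak formulation -/

section Weak

variable {E : Type*} [NormedAddCommGroup E] [InnerProductSpace ℝ E] [FiniteDimensional ℝ E]
  [MeasurableSpace E] [BorelSpace E]
variable {ν : ℝ} {W : E → E} {P : E → ℝ}

/-- **The steady equations tested against a divergence-free field**: for a classical steady
solution `(W, P)` of the unforced system (`W ∈ C²`, `P ∈ C¹`) and `φ ∈ C²_c` with `div φ = 0`,
`∫ (⟪W, (W·∇)φ⟫ + ν⟪W, Δφ⟫) = 0` (pair `−νΔW + (W·∇)W + ∇P = 0` with `φ` and integrate by parts;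
the pressure drops out).  Leray 1934 §III (17) / KNSS 2009 §4 (ii) for time-independent fields.
[cite: KochNadirashviliSereginSverak2009, §4 p. 8 (ii)] -/
theorem IsSteadyNSSolution.integral_inner_convect_add_laplacian_eq_zero
    (h : IsSteadyNSSolution ν 0 W P) {φ : E → E} (hφ : ContDiff ℝ 2 φ) (hc : HasCompactSupport φ)
    (hdiv : VectorCalculus.IsDivFree φ) :
    ∫ x, (⟪W x, convect W φ x⟫ + ν * ⟪W x, (Δ φ) x⟫) = 0 := by
  have hW2 : ContDiff ℝ 2 W := h.contDiff_velocity
  have hW1 : ContDiff ℝ 1 W := hW2.of_le one_le_two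
  have hP1 : ContDiff ℝ 1 P := h.contDiff_pressure
  have hφ1 : ContDiff ℝ 1 φ := hφ.of_le one_le_two
  have hWc : Continuous W := hW1.continuous
  have hφc : Continuous φ := hφ1.continuous
  -- the equation paired with `φ`
  have key : ∀ x, ⟪convect W W x, φ x⟫ + ⟪gradient P x, φ x⟫ = ν * ⟪(Δ W) x, φ x⟫ := by
    intro x
    have h0 := h.momentum x
    rw [Pi.zero_apply] at h0
    have e : convect W W x + gradient P x = ν • (Δ W) x := by
      rw [← sub_eq_zero, ← h0]
      abel
    rw [← inner_add_left, e, inner_smul_left]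
    simp
  -- integrability of the pairings
  have iC : Integrable (fun x => ⟪convect W W x, φ x⟫) (volume : Measure E) :=
    integrable_inner_of_hasCompactSupport_right
      ((hW1.continuous_fderiv one_ne_zero).clm_apply hWc) hφc hc
  have iL := integrable_inner_of_hasCompactSupport_right (continuous_laplacian hW2) hφc hc
  have iP := integrable_inner_of_hasCompactSupport_right (continuous_gradient_of_contDiff hP1)
    hφc hc
  have iC' : Integrable (fun x => ⟪W x, convect W φ x⟫) (volume : Measure E) :=
    integrable_inner_of_hasCompactSupport_right hWc
      ((hφ1.continuous_fderiv one_ne_zero).clm_apply hWc)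
      ((hc.fderiv (𝕜 := ℝ)).mono fun x hx => by
        contrapose! hx; simp only [mem_support, not_not] at hx; simp [convect, hx])
  have iL' : Integrable (fun x => ⟪W x, (Δ φ) x⟫) (volume : Measure E) :=
    integrable_inner_of_hasCompactSupport_right hWc (continuous_laplacian hφ)
      (hc.mono' fun x hx => by
        contrapose! hx; simp [laplacian_eq_zero_of_notMem_tsupport hx])
  -- integration by parts, term by term
  have eC : ∫ x, ⟪convect W W x, φ x⟫ = -∫ x, ⟪W x, convect W φ x⟫ := by
    have h0 := integral_inner_convect_add_eq_zero hW1 hW1 hφ1 hc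
    have hz : ∫ x, VectorCalculus.divergence W x * ⟪W x, φ x⟫ = 0 := by
      simp [h.divFree _]
    linarith
  have eL : ∫ x, ⟪(Δ W) x, φ x⟫ = ∫ x, ⟪W x, (Δ φ) x⟫ :=
    integral_inner_laplacian_comm hW2 hφ hc
  have eP : ∫ x, ⟪gradient P x, φ x⟫ = 0 := by
    rw [integral_inner_gradient_eq_neg_integral_mul_divergence hP1 hφ1 hc]
    simp [hdiv _]
  have hint : (∫ x, ⟪convect W W x, φ x⟫) + ∫ x, ⟪gradient P x, φ x⟫ =
      ν * ∫ x, ⟪(Δ W) x, φ x⟫ := by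
    rw [← integral_add iC iP, ← integral_const_mul]
    exact integral_congr_ae (Eventually.of_forall key)
  rw [integral_add iC' (iL'.const_mul ν), integral_const_mul, ← eL, ← hint, eC, eP]
  ring

/-- **Bounded classical steady solutions are bounded weak solutions (KNSS class).** A `C²/C¹`
steady solution `(W, P)` of the unforced system with `‖W‖ ≤ M`, viewed as the time-independent
field `u(t) = W`, is a bounded weak Navier–Stokes solution on every time interval `(a, b)`
(`IsBoundedWeakNSSolutionOn`, KNSS 2009 §4 (ii)): the spatial part of the weak identity vanishes
slice by slice (`integral_inner_convect_add_laplacian_eq_zero`) and the `∂ₜψ` part is the time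
integral of the exact derivative `∂ₜ⟪W, ψ⟫` over a compact interval containing the time support of
the test field.  (Twin of `IsClassicalNSSolutionOn.isBoundedWeakNSSolutionOn`, which asks joint
smoothness.) [cite: KochNadirashviliSereginSverak2009, §4 p. 8 (ii)] -/
theorem IsSteadyNSSolution.isBoundedWeakNSSolutionOn_const (h : IsSteadyNSSolution ν 0 W P)
    {M : ℝ} (hM : ∀ x, ‖W x‖ ≤ M) (a b : ℝ) :
    IsBoundedWeakNSSolutionOn (Ioo a b) isOpen_Ioo ν (fun _ : ℝ => W) := by
  have hW1 : ContDiff ℝ 1 W := h.contDiff_velocity.of_le one_le_two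
  have hWc : Continuous W := hW1.continuous
  refine ⟨?_, ⟨M, fun _ _ y => hM y⟩, ?_, ?_⟩
  · exact (hWc.comp continuous_snd).aestronglyMeasurable
  · exact Eventually.of_forall fun t =>
      VectorCalculus.IsDivFree.isWeaklyDivFree_holds h.divFree hW1
  intro ψ hψ hdiv
  rcases le_or_gt b a with hab | hab
  · simp [Ioo_eq_empty_of_le hab]
  -- time support `[a', b'] ⊂ (a, b)` and a compact interval `[a₁, b₁]` around it
  obtain ⟨a', b', haa', ha'b', hb'b, hsupp⟩ := hψ.exists_time_support_Ioo hab
  set a₁ : ℝ := (a + a') / 2 with ha₁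
  set b₁ : ℝ := (b' + b) / 2 with hb₁
  have haa₁ : a < a₁ := by rw [ha₁]; linarith
  have ha₁a' : a₁ < a' := by rw [ha₁]; linarith
  have hb'b₁ : b' < b₁ := by rw [hb₁]; linarith
  have hb₁b : b₁ < b := by rw [hb₁]; linarith
  have ha₁b₁ : a₁ < b₁ := by linarith
  -- values of `ψ` and its derived fields off the time support
  have hψ0 : ∀ t, t ∉ Icc a' b' → ∀ x, ψ t x = 0 := fun t ht x => by rw [hsupp t ht]; rfl
  have hψa₁ : ∀ x, ψ a₁ x = 0 := hψ0 a₁ fun ht => (not_le.2 ha₁a') ht.1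
  have hψb₁ : ∀ x, ψ b₁ x = 0 := hψ0 b₁ fun ht => (not_le.2 hb'b₁) ht.2
  have hzero : ∀ t, t ∉ Icc a' b' → ∀ x,
      ⟪W x, timeDeriv ψ t x⟫ + ⟪W x, convect W (ψ t) x⟫ + ν * ⟪W x, Δ (ψ t) x⟫ = 0 := by
    intro t ht x
    have hopen : IsOpen (Icc a' b')ᶜ := isClosed_Icc.isOpen_compl
    have hnear : (fun s => ψ s x) =ᶠ[𝓝 t] fun _ => (0 : E) :=
      Filter.eventually_of_mem (hopen.mem_nhds ht) fun s hs => hψ0 s hs x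
    have h1 : timeDeriv ψ t x = 0 := by
      rw [timeDeriv_apply, hnear.deriv_eq, deriv_const]
    have h2 : fderiv ℝ (ψ t) x = 0 := by
      rw [show ψ t = fun _ => (0 : E) from funext (hψ0 t ht), fderiv_fun_const, Pi.zero_apply]
    have h3 : Δ (ψ t) x = 0 :=
      laplacian_eq_zero_of_notMem_tsupport (by
        rw [hsupp t ht, tsupport_eq_empty_iff.2 rfl]; exact notMem_empty x)
    rw [h1, convect_apply, h2, h3]
    simp
  -- reduce the time integral to `(a₁, b₁)`
  rw [setIntegral_eq_of_subset_of_forall_sdiff_eq_zero (measurableSet_Ioo (a := a) (b := b))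
    (Ioo_subset_Ioo haa₁.le hb₁b.le : Ioo a₁ b₁ ⊆ Ioo a b)]
  swap
  · intro t ht
    have ht' : t ∉ Icc a' b' := fun h' => ht.2 ⟨ha₁a'.trans_le h'.1, h'.2.trans_lt hb'b₁⟩
    simp only [hzero t ht', integral_zero]
  -- the compact `x`-shadow of the test field
  obtain ⟨K, hK, hKt⟩ := hψ.exists_compact_slice_subset
  have hψK : ∀ t, ∀ x ∉ K, ψ t x = 0 := fun t x hx =>
    image_eq_zero_of_notMem_tsupport fun h' => hx (hKt t h')
  -- the space–time integrand `∂ₜ ⟪W, ψ⟫`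
  set D : ℝ × E → ℝ := fun z => ⟪W z.2, timeDeriv ψ z.1 z.2⟫ with hD
  have hDcont : ContinuousOn D (Icc a₁ b₁ ×ˢ univ) :=
    ((hWc.comp continuous_snd).inner hψ.continuous_timeDeriv).continuousOn
  have hDK : ∀ t ∈ Icc a₁ b₁, ∀ x ∉ K, D (t, x) = 0 := fun t _ x hx => by
    simp only [hD]
    rw [timeDeriv_eq_zero_of_forall (fun s => hψK s x hx)]
    simp
  have hDint := integrable_prod_of_continuousOn hK hDcont hDK
  -- slice identity for every `t`
  have hslice : ∀ t ∈ Ioo a₁ b₁, ∫ x, (⟪W x, timeDeriv ψ t x⟫ + ⟪W x, convect W (ψ t) x⟫ +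
      ν * ⟪W x, (Δ (ψ t)) x⟫) = ∫ x, D (t, x) := by
    intro t _
    have hψ2 : ContDiff ℝ 2 (ψ t) := contDiff_infty.1 (hψ.contDiff_slice t) 2
    have hψ1 : ContDiff ℝ 1 (ψ t) := hψ2.of_le one_le_two
    have key := h.integral_inner_convect_add_laplacian_eq_zero hψ2 (hψ.hasCompactSupport_slice t)
      (hdiv t)
    have i1 : Integrable (fun x => ⟪W x, timeDeriv ψ t x⟫) (volume : Measure E) :=
      integrable_inner_of_hasCompactSupport_right hWc
        (hψ.continuous_timeDeriv.comp (Continuous.prodMk_right t))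
        (HasCompactSupport.intro hK fun x hx => timeDeriv_eq_zero_of_forall
          (fun s => hψK s x hx) t)
    have iC' : Integrable (fun x => ⟪W x, convect W (ψ t) x⟫) (volume : Measure E) :=
      integrable_inner_of_hasCompactSupport_right hWc
        ((hψ1.continuous_fderiv one_ne_zero).clm_apply hWc)
        (((hψ.hasCompactSupport_slice t).fderiv (𝕜 := ℝ)).mono fun x hx => by
          contrapose! hx; simp only [mem_support, not_not] at hx; simp [convect, hx])
    have iL' : Integrable (fun x => ν * ⟪W x, (Δ (ψ t)) x⟫) (volume : Measure E) :=
      (integrable_inner_of_hasCompactSupport_right hWc (continuous_laplacian hψ2)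
        ((hψ.hasCompactSupport_slice t).mono' fun x hx => by
          contrapose! hx; simp [laplacian_eq_zero_of_notMem_tsupport hx])).const_mul ν
    calc ∫ x, (⟪W x, timeDeriv ψ t x⟫ + ⟪W x, convect W (ψ t) x⟫ + ν * ⟪W x, (Δ (ψ t)) x⟫)
        = ∫ x, (⟪W x, timeDeriv ψ t x⟫ + (⟪W x, convect W (ψ t) x⟫ +
          ν * ⟪W x, (Δ (ψ t)) x⟫)) :=
          integral_congr_ae (Eventually.of_forall fun x => by ring)
      _ = (∫ x, ⟪W x, timeDeriv ψ t x⟫) + ∫ x, (⟪W x, convect W (ψ t) x⟫ +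
          ν * ⟪W x, (Δ (ψ t)) x⟫) := integral_add i1 (iC'.add iL')
      _ = ∫ x, D (t, x) := by rw [key, add_zero]
  -- integrate the slice identity in time and swap the integrals
  have hstep : ∫ t in Ioo a₁ b₁, ∫ x, (⟪W x, timeDeriv ψ t x⟫ + ⟪W x, convect W (ψ t) x⟫ +
      ν * ⟪W x, (Δ (ψ t)) x⟫) = ∫ x, ∫ t in Ioo a₁ b₁, D (t, x) := by
    rw [setIntegral_congr_fun measurableSet_Ioo hslice]
    exact integral_integral_swap (f := fun t x => D (t, x)) hDint
  -- fundamental theorem of calculus on each time line: both boundary terms vanish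
  have hline : ∀ x, ∫ t in Ioo a₁ b₁, D (t, x) = 0 := by
    intro x
    have hcont : ContinuousOn (fun t => ⟪W x, ψ t x⟫) (Icc a₁ b₁) :=
      (continuous_const.inner (hψ.contDiff.continuous.comp (Continuous.prodMk_left x))).continuousOn
    have hderiv : ∀ t ∈ Ioo a₁ b₁, HasDerivWithinAt (fun t => ⟪W x, ψ t x⟫) (D (t, x))
        (Ioi t) t := by
      intro t _
      have h' := (hasDerivAt_const t (W x)).inner ℝ (hψ.hasDerivAt_time t x)
      simp only [inner_zero_left, add_zero] at h'
      exact h'.hasDerivWithinAt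
    have hint : IntervalIntegrable (fun t => D (t, x)) volume a₁ b₁ := by
      refine ContinuousOn.intervalIntegrable ?_
      rw [uIcc_of_le ha₁b₁.le]
      exact hDcont.comp (Continuous.prodMk_left x).continuousOn
        fun t ht => mk_mem_prod ht (mem_univ x)
    have := intervalIntegral.integral_eq_sub_of_hasDeriv_right_of_le ha₁b₁.le hcont hderiv hint
    rw [intervalIntegral.integral_of_le ha₁b₁.le, integral_Ioc_eq_integral_Ioo] at this
    rw [this, hψa₁ x, hψb₁ x, inner_zero_right, sub_self]
  rw [hstep, integral_congr_ae (Eventually.of_forall hline), integral_zero]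

omit [MeasurableSpace E] [BorelSpace E] in
/-- **The pressure of a steady solution with smooth velocity (and force) is smooth**:
`∇P = f + νΔU − (U·∇)U ∈ C^∞`, so `DP = ⟪∇P, ·⟫ ∈ C^∞` (Tsai 1998 p. 34 "if `U` is smooth,
`P` is also smooth"; the steady-class twin of `IsLerayProfile.contDiff_pressure_of_smooth`).
[cite: Tsai1998, §2 (p. 34)] -/
theorem IsSteadyNSSolution.contDiff_pressure_of_smooth {f : E → E}
    (h : IsSteadyNSSolution ν f W P) (hW : ContDiff ℝ (⊤ : ℕ∞) W)
    (hf : ContDiff ℝ (⊤ : ℕ∞) f) : ContDiff ℝ (⊤ : ℕ∞) P := by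
  have hgrad : gradient P = fun y => f y + ν • (Δ W) y - convect W W y := by
    funext y
    have h0 := h.momentum y
    rw [← sub_eq_zero, ← h0]
    abel
  have hΔ : ContDiff ℝ (⊤ : ℕ∞) (Δ W) :=
    contDiff_laplacian (n := (⊤ : ℕ∞)) (by exact_mod_cast hW)
  have hconv : ContDiff ℝ (⊤ : ℕ∞) (convect W W) :=
    (hW.fderiv_right (m := (⊤ : ℕ∞)) le_rfl).clm_apply hW
  have hg : ContDiff ℝ (⊤ : ℕ∞) (gradient P) := by
    rw [hgrad]
    exact (hf.add (hΔ.const_smul ν)).sub hconv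
  have hfd : fderiv ℝ P = fun y => (InnerProductSpace.toDual ℝ E) (gradient P y) := by
    funext y
    simp [gradient]
  rw [contDiff_infty_iff_fderiv, hfd]
  exact ⟨h.contDiff_pressure.differentiable (by simp),
    (InnerProductSpace.toDual ℝ E).contDiff.comp hg⟩

omit [InnerProductSpace ℝ E] [FiniteDimensional ℝ E] [MeasurableSpace E] [BorelSpace E] in
/-- A continuous field tending to `0` at infinity is bounded (private copy of
`SteadyLiouvilleCriteriaProofs.exists_forall_norm_le_of_tendsto_cocompact`, to keep this file's
imports inside the Oseen cone). [folklore] -/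
private theorem exists_bound_of_tendsto_cocompact_zero {F : Type*} [NormedAddCommGroup F]
    {u : E → F} (hu : Continuous u) (hdec : Tendsto u (cocompact E) (𝓝 0)) :
    ∃ M, ∀ x, ‖u x‖ ≤ M := by
  have hev : ∀ᶠ y in cocompact E, ‖u y‖ < 1 :=
    hdec.norm.eventually (isOpen_Iio.mem_nhds (by simp : ‖(0 : F)‖ < 1))
  obtain ⟨K, hK, hKc⟩ := mem_cocompact.1 hev
  obtain ⟨M₀, hM₀⟩ : ∃ M₀, ∀ y ∈ K, ‖u y‖ ≤ M₀ :=
    hK.exists_bound_of_continuousOn hu.continuousOn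
  refine ⟨max M₀ 1, fun x => ?_⟩
  by_cases hx : x ∈ K
  · exact (hM₀ x hx).trans (le_max_left _ _)
  · exact (le_of_lt (hKc hx)).trans (le_max_right _ _)

end Weak

/-! ### Regularity on `ℝ³`: Oseen-mild, real-analytic, smooth -/

section Regularity

variable {ν : ℝ} {W : EuclideanSpace ℝ (Fin 3) → EuclideanSpace ℝ (Fin 3)}
  {P : EuclideanSpace ℝ (Fin 3) → ℝ}

/-- **Bounded `C²/C¹` steady solutions on `ℝ³` are Oseen-mild** (unit viscosity): for every
`τ > 0`, `W = e^{τΔ}W − B¹₀(W, W)(τ)` pointwise — `SteadyNSBoundedMild` run on the bounded weak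
solution `u(t) = W` of `isBoundedWeakNSSolutionOn_const` (KNSS 2009 Lemma 3.1 + the steady drift
kill). [cite: KochNadirashviliSereginSverak2009, §3 Lemma 3.1 and §1 p. 3 (arXiv:0709.3599)] -/
theorem IsSteadyNSSolution.eq_heatExtension_sub_oseenDuhamel (h : IsSteadyNSSolution 1 0 W P)
    {M : ℝ} (hM : ∀ x, ‖W x‖ ≤ M) {τ : ℝ} (hτ : 0 < τ) (x : EuclideanSpace ℝ (Fin 3)) :
    W x = heatExtension W τ x - oseenDuhamel 1 0 (fun _ : ℝ => W) (fun _ : ℝ => W) τ x :=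
  eq_heatExtension_sub_oseenDuhamel_of_isBoundedWeakNSSolutionOn h.contDiff_velocity.continuous hM
    (fun T _ => h.isBoundedWeakNSSolutionOn_const hM 0 T) hτ x

/-- **Bounded `C²/C¹` steady Navier–Stokes flows on `ℝ³` are real-analytic** (unit viscosity;
the `C²/C¹` version of `IsSteadyClassicalNS.analyticOnNhd_of_bounded`, same proof: the steady field
is Oseen-mild and coincides, by uniqueness of bounded mild solutions, with the real-analytic local
Oseen solution from its own datum). [cite: LemarieRieusset2016, Thm. 9.12 (PDF p. 260; proof pp. 260–263)] -/
theorem IsSteadyNSSolution.analyticOnNhd_of_bounded (h : IsSteadyNSSolution 1 0 W P) {M : ℝ}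
    (hM : ∀ x, ‖W x‖ ≤ M) : AnalyticOnNhd ℝ W univ := by
  have hWc : Continuous W := h.contDiff_velocity.continuous
  -- a positive bound
  set M₁ : ℝ := max M 1 with hM₁
  have hM₁0 : 0 < M₁ := lt_of_lt_of_le one_pos (le_max_right _ _)
  have hM₁ : ∀ x, ‖W x‖ ≤ M₁ := fun x => (hM x).trans (le_max_left _ _)
  -- the local analytic solution of Oseen's scheme from the datum `W` at time `0`
  obtain ⟨ε, hε, CA, hCA, hloc⟩ := lemarieRieusset2016_local_analyticity_holds
  have hWess : eLpNorm W ∞ volume ≤ ENNReal.ofReal M₁ := by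
    rw [eLpNorm_exponent_top]
    exact eLpNormEssSup_le_of_ae_bound (Eventually.of_forall hM₁)
  obtain ⟨v, hv_an, hv_eq, hv_bd⟩ := hloc one_pos 0 hM₁0 hWc.aestronglyMeasurable hWess
  set T : ℝ := 0 + ε * 1 / M₁ ^ 2 with hT
  have hT0 : 0 < T := by rw [hT]; positivity
  -- uniqueness of bounded solutions of Oseen's integral equation on `(0, T)`
  set u : ℝ → EuclideanSpace ℝ (Fin 3) → EuclideanSpace ℝ (Fin 3) := fun _ => W
  set M' : ℝ := max M₁ (CA * M₁) with hM'
  have hM'0 : 0 ≤ M' := hM₁0.le.trans (le_max_left _ _)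
  have hum : AEStronglyMeasurable (uncurry u)
      ((volume : Measure (ℝ × EuclideanSpace ℝ (Fin 3))).restrict (Ioo 0 T ×ˢ univ)) :=
    (hWc.comp continuous_snd).aestronglyMeasurable
  have hvm : AEStronglyMeasurable (uncurry v)
      ((volume : Measure (ℝ × EuclideanSpace ℝ (Fin 3))).restrict (Ioo 0 T ×ˢ univ)) :=
    hv_an.continuousOn.aestronglyMeasurable (measurableSet_Ioo.prod MeasurableSet.univ)
  have huM : ∀ τ ∈ Ioo 0 T, ∀ y, ‖u τ y‖ ≤ M' := fun _ _ y => (hM₁ y).trans (le_max_left _ _)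
  have hvM : ∀ τ ∈ Ioo 0 T, ∀ y, ‖v τ y‖ ≤ M' := fun τ hτ y =>
    (hv_bd τ hτ y).trans (le_max_right _ _)
  have hu : ∀ t ∈ Ioo 0 T, u t =ᵐ[volume] fun x =>
      heatExtension W (1 * (t - 0)) x - oseenDuhamel 1 0 u u t x := fun t ht =>
    Eventually.of_forall fun x => by
      rw [one_mul, sub_zero]
      exact h.eq_heatExtension_sub_oseenDuhamel hM ht.1 x
  have hv : ∀ t ∈ Ioo 0 T, v t =ᵐ[volume] fun x =>
      heatExtension W (1 * (t - 0)) x - oseenDuhamel 1 0 v v t x := fun t ht =>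
    Eventually.of_forall fun x => hv_eq t ht x
  have huniq := oseenMild_bounded_unique (U := fun t x => heatExtension W (1 * (t - 0)) x)
    one_pos hM'0 hum hvm huM hvM hu hv
  -- the slice at `t₀ = T/2`
  have ht₀ : T / 2 ∈ Ioo 0 T := ⟨by positivity, by linarith⟩
  have hslice : AnalyticOnNhd ℝ (v (T / 2)) univ := by
    intro x _
    have hA : AnalyticAt ℝ (uncurry v) (T / 2, x) := hv_an _ ⟨ht₀, mem_univ _⟩
    have hι : AnalyticAt ℝ (fun y : EuclideanSpace ℝ (Fin 3) => ((T / 2 : ℝ), y)) x :=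
      analyticAt_const.prod analyticAt_id
    exact hA.comp hι
  have hae : W =ᵐ[volume] v (T / 2) := huniq _ ht₀
  have heq : W = v (T / 2) :=
    (Continuous.ae_eq_iff_eq volume hWc hslice.continuous).1 hae
  rw [heq]
  exact hslice

/-- **Bounded `C²/C¹` steady Navier–Stokes solutions on `ℝ³` are smooth**, velocity AND pressure,
for every viscosity `ν > 0` (normalise `(W, P) ↦ (ν⁻¹W, ν⁻²P)` to unit viscosity; the velocity is
real-analytic, `∇P = νΔW − (W·∇)W`). The whole-space, bounded-velocity case of the interior
regularity of steady solutions (Galdi 2011 Thm X.1.1; Wang 2025 p. 28: weak solutions of (0.1) in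
`W^{1,2}_loc` are smooth). [cite: Galdi2011, Thm X.1.1] -/
theorem IsSteadyNSSolution.contDiff_of_bounded (hν : 0 < ν) (h : IsSteadyNSSolution ν 0 W P)
    {M : ℝ} (hM : ∀ x, ‖W x‖ ≤ M) :
    ContDiff ℝ (⊤ : ℕ∞) W ∧ ContDiff ℝ (⊤ : ℕ∞) P := by
  have hν0 : ν ≠ 0 := hν.ne'
  have h1 : IsSteadyNSSolution 1 0 (ν⁻¹ • W) (ν⁻¹ ^ 2 • P) := by
    simpa using h.viscosity_one hν0
  have hM1 : ∀ x, ‖(ν⁻¹ • W) x‖ ≤ ν⁻¹ * M := fun x => by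
    rw [Pi.smul_apply, norm_smul, Real.norm_eq_abs, abs_of_pos (inv_pos.2 hν)]
    exact mul_le_mul_of_nonneg_left (hM x) (inv_pos.2 hν).le
  have hA := h1.analyticOnNhd_of_bounded hM1
  have hW1 : ContDiff ℝ (⊤ : ℕ∞) (ν⁻¹ • W) :=
    contDiffOn_univ.1 (hA.contDiffOn (n := (⊤ : ℕ∞)) uniqueDiffOn_univ)
  have hW : ContDiff ℝ (⊤ : ℕ∞) W := by
    have e : W = fun x => ν • (ν⁻¹ • W) x := by
      funext x; rw [Pi.smul_apply, smul_smul, mul_inv_cancel₀ hν0, one_smul]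
    rw [e]
    exact hW1.const_smul ν
  exact ⟨hW, h.contDiff_pressure_of_smooth hW contDiff_const⟩

/-- **`D`-solutions with `U → 0` at infinity are smooth** (Wang 2025 (0.1)–(0.3); p. 28 after
Galdi 2011 Thm X.1.1): the velocity is continuous and tends to `0`, hence bounded, and
`IsSteadyNSSolution.contDiff_of_bounded` applies. [cite: Galdi2011, Thm X.1.1] -/
theorem IsDSolution.contDiff_of_tendsto (hν : 0 < ν) (h : IsDSolution ν 0 W P)
    (hdec : Tendsto W (cocompact (EuclideanSpace ℝ (Fin 3))) (𝓝 0)) :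
    ContDiff ℝ (⊤ : ℕ∞) W ∧ ContDiff ℝ (⊤ : ℕ∞) P := by
  obtain ⟨M, hM⟩ := exists_bound_of_tendsto_cocompact_zero
    h.isSteadyNSSolution.contDiff_velocity.continuous hdec
  exact h.isSteadyNSSolution.contDiff_of_bounded hν hM

end Regularity

end Literature.Analysis.FluidPDE

end
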